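import Mathlib
import Summits.Ventures.PercRepro2.Defs
import Summits.Ventures.PercRepro2.Graph
import Summits.Ventures.PercRepro2.OneColourSwitch
import Summits.Ventures.PercRepro2.RegionHubSign
import Summits.Ventures.PercRepro2.SideSwitch
import Summits.Ventures.PercRepro2.SideSwitchFibre
import Summits.Ventures.PercRepro2.SideSwitchClosed
import Summits.Ventures.PercRepro2.SideSwitchComps

/-!
# The fibration of `Sep` over the representatives by component assignments (blind cell
PercRepro2, p3 g18, 2026-08-27; `proofs/P3-CPNC.md` §15c, general form)

When no non-mark lies in both worlds (`DZero`), the `W`-side of every `Sep`-colouring is a union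
of components of the sided set (`compIn_subset_Bside`, `unionT_filter_Bside`), so the component
assignments `assignC T ρ = ρ ⊕ touches (⋃ T)` of the representatives `ρ` enumerate `Sep`
exactly once: `(ρ, T) ↦ assignC T ρ` is a bijection `Rep × 2^{comps ρ} → Sep`
(`sum_sep_eq_sum_rep_comps`).  Own work; std axioms.
-/

namespace Summit.Ventures.PercRepro2

namespace SideSwitch

open Finset Classical RegionHub OneColourSwitch

variable {V : Type*} {E : Type*}

section Count

variable [Fintype V] [DecidableEq V]

variable {ends : E → Sym2 V}

/-- Under `DZero`, the component of a `W`-side vertex lies on the `W`-side. -/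
lemma compIn_subset_Bside {p q r s : V} {ω : Config E} (_h : sep2 ends p q r s ω)
    (hD : DZero ends r s ω) {x : V} (hx : x ∈ Bside ends r s ω) :
    compIn ends (↑(A0 ends r s ω) : Set V) x ⊆ Bside ends r s ω := by
  intro y hy
  rw [mem_compIn] at hy
  let Z : Set V := {z | z ∈ A0 ends r s ω → z ∈ Bside ends r s ω}
  have hcl : ∀ a ∈ Z, ∀ b, (openGraph ends (chi ends (↑(A0 ends r s ω) : Set V))).Adj a b → b ∈ Z := by
    intro a ha b hab hbA
    obtain ⟨_, e, he, hends⟩ := openGraph_adj.1 hab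
    obtain ⟨u, hu, v, hv, huv⟩ := chi_eq_true_iff.1 he
    have haA : a ∈ A0 ends r s ω := by
      rw [hends, Sym2.eq_iff] at huv
      rcases huv with ⟨h1, _⟩ | ⟨h1, _⟩
      · rw [h1]; exact Finset.mem_coe.1 hu
      · rw [h1]; exact Finset.mem_coe.1 hv
    obtain ⟨haM, har, has⟩ := mem_Bside.1 (ha haA)
    obtain ⟨hbU, hbr, hbs⟩ := mem_A0.1 hbA
    refine mem_Bside.2 ⟨?_, hbr, hbs⟩
    by_contra hbM
    -- `b ∈ K₂ ∖ M₂` adjacent to `a ∈ M₂`: the edge is open, so `a ∈ K₂`, against `DZero`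
    have he1 : ω e = true := open_of_mem_M2_of_not_mem' haM hbM hends
    have hbK : b ∈ K2 ends r s ω := by
      rcases hbU with hbK | hbM'
      · exact hbK
      · exact (hbM hbM').elim
    have haK : a ∈ K2 ends r s ω := mem_K2_of_open hbK he1 (by rw [hends, Sym2.eq_swap])
    exact hD a har has haK haM
  have hxZ : x ∈ Z := fun _ => hx
  have hyZ : y ∈ Z := mem_of_conn_of_closed hcl hxZ hy
  exact hyZ (Finset.mem_coe.1 (mem_of_mem_compIn
    (Finset.mem_coe.2 (Bside_subset_A0 r s ω hx)) (mem_compIn.2 hy)))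

/-- Under `DZero`, the `W`-side is closed inside the sided set. -/
lemma closedIn_Bside {p q r s : V} {ω : Config E} (h : sep2 ends p q r s ω)
    (hD : DZero ends r s ω) : ClosedIn ends (sided ends r s ω) (↑(Bside ends r s ω) : Set V) := by
  intro e a b hends ha hb
  rw [sided_eq_coe_A0] at hb
  have haA : a ∈ A0 ends r s ω := Bside_subset_A0 r s ω (Finset.mem_coe.1 ha)
  have he : chi ends (↑(A0 ends r s ω) : Set V) e = true :=
    chi_eq_true_iff.2 ⟨a, Finset.mem_coe.2 haA, b, hb, hends⟩
  exact Finset.mem_coe.2 (compIn_subset_Bside h hD (Finset.mem_coe.1 ha)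
    (mem_compIn.2 (conn_of_openAdj ⟨e, he, hends⟩)))

/-- Under `DZero`, the `W`-side is the union of the components it contains. -/
lemma unionT_filter_Bside {p q r s : V} {ω : Config E} (h : sep2 ends p q r s ω)
    (hD : DZero ends r s ω) :
    unionT ((comps ends r s ω).filter (fun C => C ⊆ Bside ends r s ω)) = Bside ends r s ω := by
  ext x
  rw [mem_unionT]
  constructor
  · rintro ⟨C, hC, hxC⟩
    exact (Finset.mem_filter.1 hC).2 hxC
  · intro hx
    exact ⟨compIn ends (↑(A0 ends r s ω) : Set V) x, Finset.mem_filter.2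
      ⟨Finset.mem_image.2 ⟨x, Bside_subset_A0 r s ω hx, rfl⟩, compIn_subset_Bside h hD hx⟩,
      mem_compIn_self _ _⟩

/-! ## Side assignments by components -/

/-- The switch data of a union of components. -/
lemma switch_data_unionT {r s : V} {ρ : Config E} {T : Finset (Finset V)}
    (hT : T ⊆ comps ends r s ρ) :
    (↑(unionT T) : Set V) ⊆ K2 ends r s ρ ∪ M2 ends r s ρ ∧ r ∉ (↑(unionT T) : Set V) ∧
      s ∉ (↑(unionT T) : Set V) ∧ ClosedIn ends (sided ends r s ρ) (↑(unionT T) : Set V) := by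
  obtain ⟨h1, h2, h3⟩ := subset_U2_of_subset_A0 (unionT_subset_A0 hT)
  exact ⟨h1, h2, h3, closedIn_unionT hT⟩

/-- A component assignment of a `Sep`-colouring is a `Sep`-colouring. -/
lemma sep2_assignC {p q r s : V} {ρ : Config E} (h : sep2 ends p q r s ρ)
    {T : Finset (Finset V)} (hT : T ⊆ comps ends r s ρ) : sep2 ends p q r s (assignC ends T ρ) := by
  obtain ⟨h1, h2, h3, h4⟩ := switch_data_unionT hT
  exact sep2_flipTouch_of_closed h h1 h2 h3 h4

/-- `A0` is preserved by a component assignment. -/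
lemma A0_assignC {p q r s : V} {ρ : Config E} (h : sep2 ends p q r s ρ)
    {T : Finset (Finset V)} (hT : T ⊆ comps ends r s ρ) :
    A0 ends r s (assignC ends T ρ) = A0 ends r s ρ := by
  obtain ⟨h1, h2, h3, h4⟩ := switch_data_unionT hT
  ext x
  simp only [mem_A0, assignC, assign]
  rw [U2_flipTouch_of_closed h h1 h2 h3 h4]

/-- The components are preserved by a component assignment. -/
lemma comps_assignC {p q r s : V} {ρ : Config E} (h : sep2 ends p q r s ρ)
    {T : Finset (Finset V)} (hT : T ⊆ comps ends r s ρ) :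
    comps ends r s (assignC ends T ρ) = comps ends r s ρ := by
  simp only [comps, A0_assignC h hT]

variable [Fintype E] [DecidableEq E]

/-- The `W`-side of a component assignment of a representative is the assigned union. -/
lemma Bside_assignC {p q r s : V} {ρ : Config E} (hρ : ρ ∈ Rep ends p q r s)
    {T : Finset (Finset V)} (hT : T ⊆ comps ends r s ρ) :
    Bside ends r s (assignC ends T ρ) = unionT T := by
  obtain ⟨h, hM⟩ := mem_Rep.1 hρ
  obtain ⟨h1, h2, h3, h4⟩ := switch_data_unionT hT
  have hTA := unionT_subset_A0 hT
  ext x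
  simp only [mem_Bside, assignC, assign]
  rw [M2_flipTouch_of_closed h h1 h2 h3 h4]
  constructor
  · rintro ⟨(⟨hxM, _⟩ | ⟨hxT, _⟩), hr, hs⟩
    · rcases hM x hxM with h' | h'
      · exact (hr h').elim
      · exact (hs h').elim
    · exact hxT
  · intro hxT
    refine ⟨Or.inr ⟨hxT, A0_subset_K2_of_mem_Rep hρ (hTA hxT)⟩, ?_, ?_⟩
    · rintro rfl; exact h2 hxT
    · rintro rfl; exact h3 hxT

/-- `nu` of a component assignment of a representative is the representative. -/
lemma nu_assignC {p q r s : V} {ρ : Config E} (hρ : ρ ∈ Rep ends p q r s)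
    {T : Finset (Finset V)} (hT : T ⊆ comps ends r s ρ) : nu ends r s (assignC ends T ρ) = ρ := by
  rw [nu, Bside_assignC hρ hT, assignC, assign, flipTouch_flipTouch]

/-- `nu` of a `Sep`-colouring with no doubly reached non-mark is a representative. -/
lemma nu_mem_Rep_of_DZero {p q r s : V} {ω : Config E} (h : sep2 ends p q r s ω)
    (hD : DZero ends r s ω) : nu ends r s ω ∈ Rep ends p q r s := by
  obtain ⟨hC, hCr, hCs⟩ := subset_U2_of_subset_A0 (Bside_subset_A0 (ends := ends) r s ω)
  have hcl := closedIn_Bside h hD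
  rw [mem_Rep, nu]
  refine ⟨sep2_flipTouch_of_closed h hC hCr hCs hcl, ?_⟩
  intro x hx
  rw [M2_flipTouch_of_closed h hC hCr hCs hcl] at hx
  rcases hx with ⟨hxM, hxB⟩ | ⟨hxB, hxK⟩
  · by_contra hx'
    exact hxB (mem_Bside.2 ⟨hxM, fun h1 => hx' (Or.inl h1), fun h2 => hx' (Or.inr h2)⟩)
  · obtain ⟨hxM, hr, hs⟩ := mem_Bside.1 hxB
    exact (hD x hr hs hxK hxM).elim

/-- The `Sep`-colourings are fibred over the representatives by the component assignments. -/
theorem sum_sep_eq_sum_rep_comps {p q r s : V} (hD : ∀ ω, sep2 ends p q r s ω → DZero ends r s ω)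
    (f : Config E → ℤ) :
    ∑ ω ∈ SepSet ends p q r s, f ω =
      ∑ ρ ∈ Rep ends p q r s, ∑ T ∈ (comps ends r s ρ).powerset, f (assignC ends T ρ) := by
  have hmaps : ∀ ω ∈ SepSet ends p q r s, nu ends r s ω ∈ Rep ends p q r s := fun ω hω =>
    nu_mem_Rep_of_DZero (mem_SepSet.1 hω) (hD ω (mem_SepSet.1 hω))
  rw [← Finset.sum_fiberwise_of_maps_to hmaps]
  refine Finset.sum_congr rfl (fun ρ hρ => ?_)
  refine Finset.sum_nbij' (fun ω => (comps ends r s ρ).filter (fun C => C ⊆ Bside ends r s ω))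
    (fun T => assignC ends T ρ) ?_ ?_ ?_ ?_ ?_
  · intro ω _
    exact Finset.mem_powerset.2 (Finset.filter_subset _ _)
  · intro T hT
    rw [Finset.mem_powerset] at hT
    rw [Finset.mem_filter, mem_SepSet]
    exact ⟨sep2_assignC (mem_Rep.1 hρ).1 hT, nu_assignC hρ hT⟩
  · intro ω hω
    rw [Finset.mem_filter] at hω
    obtain ⟨hωS, hων⟩ := hω
    have hsep := mem_SepSet.1 hωS
    -- the components of `ρ = nu ω` are those of `ω`
    have hcomps : comps ends r s ρ = comps ends r s ω := by
      rw [← hων]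
      have hB := closedIn_Bside hsep (hD ω hsep)
      obtain ⟨hC, hCr, hCs⟩ := subset_U2_of_subset_A0 (Bside_subset_A0 (ends := ends) r s ω)
      simp only [comps, nu]
      have hA : A0 ends r s (flipTouch ends (↑(Bside ends r s ω) : Set V) ω) = A0 ends r s ω := by
        ext x
        simp only [mem_A0]
        rw [U2_flipTouch_of_closed hsep hC hCr hCs hB]
      rw [hA]
    rw [hcomps, assignC, unionT_filter_Bside hsep (hD ω hsep), ← hων, nu, assign, flipTouch_flipTouch]
  · intro T hT
    rw [Finset.mem_powerset] at hT
    rw [Bside_assignC hρ hT, filter_subset_unionT hT]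
  · intro ω hω
    rw [Finset.mem_filter] at hω
    obtain ⟨hωS, hων⟩ := hω
    have hsep := mem_SepSet.1 hωS
    have hcomps : comps ends r s ρ = comps ends r s ω := by
      rw [← hων]
      have hB := closedIn_Bside hsep (hD ω hsep)
      obtain ⟨hC, hCr, hCs⟩ := subset_U2_of_subset_A0 (Bside_subset_A0 (ends := ends) r s ω)
      simp only [comps, nu]
      have hA : A0 ends r s (flipTouch ends (↑(Bside ends r s ω) : Set V) ω) = A0 ends r s ω := by
        ext x
        simp only [mem_A0]
        rw [U2_flipTouch_of_closed hsep hC hCr hCs hB]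
      rw [hA]
    rw [hcomps, assignC, unionT_filter_Bside hsep (hD ω hsep), ← hων, nu, assign, flipTouch_flipTouch]

end Count

end SideSwitch

end Summit.Ventures.PercRepro2
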